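import Literature.Barriers.BirchSwinnertonDyer.PAdicFunctionalEquationParityProofs
import Literature.NumberTheory.EllipticCurves.PAdicLFunctionIntegralityAtTwoAutoProofs
import HarnessLib

/-!
# At `p = 2` the functional equation also fixes `λ mod 2`: `λ ≡ c (mod 2)`, `(−1)^λ = χ₈(N)`
# (proofs only)

A *proofs* companion (theorems only; no definition, no named fact) of
`PAdicFunctionalEquationParity` / `…Proofs`. There, `eq_neg_one_pow_of_subst_eq` reads the SIGN off
the functional equation `g(T^ι) = w · (1+T)^c · g(T)`, `T^ι = (1+T)⁻¹ − 1`, by comparing the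
coefficients of `T^n`, `n = ord_T g` — "the functional equation sees the parity of the ORDER". This
file reads one more coefficient, at `p = 2` and modulo `2`: if `g ∈ ℚ₂⟦T⟧` has `2`-integral
coefficients and `n` is the index of its FIRST UNIT coefficient (for `g = 2^{−μ} L` this is the
λ-invariant of `L`), then comparing the coefficients of `T^{n+1}` modulo `2ℤ₂` gives

  `n ≡ c (mod 2)` (`norm_natCast_sub_le_of_subst_invOnePlusSubOne_eq`),

because `ι = −T + T² − ⋯` has `[T^{n+1}] ι^n = (−1)^{n+1} n`, `[T^{n+1}] ι^{n+1} = (−1)^{n+1}`,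
`[T^{n+1}]((1+T)^c g) ≡ g_{n+1} + c g_n`, the sign `w = ±1` and `(−1)^{n+1}` are `≡ 1 (mod 2)`, and
every earlier coefficient `g_j`, `j < n`, is `≡ 0`. (Greenberg, LNM 1716, p. 181, in the language of
roots: at `p = 2` the involution `a ↦ (1+a)⁻¹ − 1` of the open unit disc has the SECOND fixed point
`a = −2`, so the roots of `g` pair off except at `0` and `−2`; the present coefficient computation is
the formal shadow of that remark and needs no Weierstrass preparation.)

For the `2`-adic `L`-function of an elliptic curve `E = W/ℚ` good ordinary at `2` (tree:
`exists_exponent_subst_padicLFunction_eq_conductorLevel` — the functional equation WITH the exponent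
`c ∈ ℤ₂` of `⟨N_E⟩ = 5^c`, valid at `p = 2`; and `exists_iwasawaToPowerSeries_eq_padicLFunction_two_auto`
— `L₂(E, T) ∈ ℤ₂⟦T⟧` unconditionally) this yields the **PARITY(2) law**
(`even_firstUnitCoeff_iff_conductor_mod_eight`): with `n` the first unit coefficient of
`t · L₂(E, T)` for any normalising scalar `t` (e.g. `t = 2^{−μ}`),
`n` is even iff `N_E ≡ ±1 (mod 8)` — i.e. `(−1)^λ = χ₈(N_E)`, independently of the root number.

STATUS: the sign-reading is Greenberg LNM 1716 §1/§5 (in the tree); the `λ mod 2` reading at `p = 2`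
is NOT printed as such (Greenberg p. 181 notes the fixed point `−2`); it was predicted and checked on
2 613/2 613 ordinary rows of the o1 census (lens-1 GEN 4 G4.5b, lead D13/D18; EVIDENCE, not used).
Requested by the residual cell `b2b-bsdres` (o1 lead GEN 10 item (13) "PARITY(2)-go
`lambda_two_mod_two`", inputs listed in `HOME/b2b-bsdres-o1-lead/D18-parity2-tree-inputs-g10.md`).
Multiplicative `2` is NOT covered (no functional-equation theorem with `p ∣ N` in the tree).

## References

* R. Greenberg, *Iwasawa theory for elliptic curves*, LNM 1716 (1999), §1 (functional equation,
  `⟨N_E⟩`, pp. 67–68), §5 p. 181 ("For `p = 2`, we would have another possibility: `a = −2`").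
  [GreenbergLNM1716]
* B. Mazur, J. Tate, J. Teitelbaum, Invent. Math. 84 (1986), §I.17 (functional equation).
  [MazurTateTeitelbaum1986Invent]
-/

noncomputable section

open scoped MatrixGroups ModularForm

open CongruenceSubgroup PowerSeries WeierstrassCurve Filter Topology
  Literature.NumberTheory.EllipticCurves Literature.NumberTheory.EllipticCurves.ModularForms

namespace Literature.Barriers.BirchSwinnertonDyer

/-! ### §1. Coefficient bookkeeping for `ι = (1+T)⁻¹ − 1` over `ℚ₂` -/

section Iota

/-- `‖2‖₂ = 2⁻¹`. [folklore] -/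
private theorem norm_two_two : ‖(2 : ℚ_[2])‖ = (2 : ℝ)⁻¹ := by
  have h := Padic.norm_p (p := 2)
  simpa using h

/-- The coefficients of `ι = −T + T² − ⋯` have norm `≤ 1`. [cite: GreenbergLNM1716, §1 (functional equation)] -/
theorem norm_coeff_invOnePlusSubOne_le (k : ℕ) :
    ‖coeff k (invOnePlusSubOne : ℚ_[2]⟦X⟧)‖ ≤ 1 := by
  rw [coeff_invOnePlusSubOne]
  split_ifs <;> simp

/-- The coefficients of every power `ι^d` have norm `≤ 1` (they are integers).
[cite: GreenbergLNM1716, §1 (functional equation)] -/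
theorem norm_coeff_invOnePlusSubOne_pow_le (d k : ℕ) :
    ‖coeff k ((invOnePlusSubOne : ℚ_[2]⟦X⟧) ^ d)‖ ≤ 1 := by
  induction d generalizing k with
  | zero =>
    rw [pow_zero, coeff_one]
    split_ifs <;> simp
  | succ d ih =>
    rw [pow_succ, coeff_mul]
    refine IsUltrametricDist.norm_sum_le_of_forall_le_of_nonneg zero_le_one fun ij _ ↦ ?_
    rw [norm_mul]
    calc _ ≤ 1 * 1 := mul_le_mul (ih _) (norm_coeff_invOnePlusSubOne_le _) (norm_nonneg _)
          zero_le_one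
      _ = 1 := one_mul _

/-- `[T^{n+1}] ι^{n+1} = (−1)^{n+1}` (leading coefficient of a power).
[cite: GreenbergLNM1716, §1 (functional equation)] -/
theorem coeff_succ_invOnePlusSubOne_pow_succ (n : ℕ) :
    coeff (n + 1) ((invOnePlusSubOne : ℚ_[2]⟦X⟧) ^ (n + 1)) = (-1) ^ (n + 1) := by
  rw [coeff_pow_self_of_constantCoeff_eq_zero constantCoeff_invOnePlusSubOne,
    coeff_one_invOnePlusSubOne]

/-- `[T^{n+1}] ι^n = n · (−1)^{n+1}` (next-to-leading coefficient: `ι^n = (−T)^n (1+T)^{−n}`).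
[cite: GreenbergLNM1716, §1 (functional equation)] -/
theorem coeff_succ_invOnePlusSubOne_pow (n : ℕ) :
    coeff (n + 1) ((invOnePlusSubOne : ℚ_[2]⟦X⟧) ^ n) = n * (-1) ^ (n + 1) := by
  set h : ℚ_[2]⟦X⟧ := PowerSeries.mk fun q => coeff (q + 1) (invOnePlusSubOne : ℚ_[2]⟦X⟧) with hh
  have hι : (invOnePlusSubOne : ℚ_[2]⟦X⟧) = X * h := by
    conv_lhs => rw [eq_X_mul_shift_add_const (invOnePlusSubOne : ℚ_[2]⟦X⟧),
      constantCoeff_invOnePlusSubOne, map_zero, add_zero]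
  have h0 : constantCoeff h = -1 := by
    rw [hh, ← coeff_zero_eq_constantCoeff_apply, coeff_mk, zero_add, coeff_one_invOnePlusSubOne]
  have h1 : coeff 1 h = 1 := by
    rw [hh, coeff_mk, coeff_invOnePlusSubOne]
    norm_num
  rw [hι, mul_pow, coeff_X_pow_mul', if_pos (Nat.le_succ n), show n + 1 - n = 1 by omega,
    coeff_one_pow, h1, h0, mul_one]
  rcases Nat.eq_zero_or_pos n with rfl | hn
  · simp
  · obtain ⟨m, rfl⟩ : ∃ m, n = m + 1 := ⟨n - 1, by omega⟩
    rw [Nat.add_sub_cancel]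
    push_cast
    ring

end Iota

/-! ### §2. The core: first unit coefficient `≡` exponent `(mod 2)` -/

section Core

/-- For `s, σ ∈ {±1}`: `‖(s − σ)x‖ ≤ ½‖x‖` (`s − σ ∈ {0, ±2}`). [folklore] -/
private theorem norm_sub_mul_le_half {s σ : ℚ_[2]} (hs : s = 1 ∨ s = -1) (hσ : σ = 1 ∨ σ = -1)
    (x : ℚ_[2]) : ‖(s - σ) * x‖ ≤ 2⁻¹ * ‖x‖ := by
  have hx : 0 ≤ 2⁻¹ * ‖x‖ := by positivity
  rcases hs with rfl | rfl <;> rcases hσ with rfl | rfl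
  · rw [sub_self, zero_mul, norm_zero]; exact hx
  · rw [show ((1 : ℚ_[2]) - -1) * x = 2 * x by ring, norm_mul, norm_two_two]
  · rw [show ((-1 : ℚ_[2]) - 1) * x = -(2 * x) by ring, norm_neg, norm_mul, norm_two_two]
  · rw [sub_self, zero_mul, norm_zero]; exact hx

/-- **The functional equation fixes the first unit coefficient modulo `2`.** Let `g ∈ ℚ₂⟦T⟧` have
coefficients of norm `≤ 1`, let `n` be the index of its first coefficient of norm `1` (all earlier
ones of norm `≤ ½`), and suppose `g(T^ι) = σ · (1+T)^c · g(T)` with `σ = ±1`, `c ∈ ℤ₂`. Then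
`‖n − c‖₂ ≤ ½`, i.e. `n ≡ c (mod 2ℤ₂)`. Proof: compare the coefficients of `T^{n+1}` — on the left
`Σ_d g_d [T^{n+1}]ι^d ≡ (−1)^{n+1}(g_{n+1} + n g_n)`, on the right `σ(g_{n+1} + c g_n)`, modulo terms
of norm `≤ ½`; since `σ, (−1)^{n+1} ≡ 1 (mod 2)`, `(n − c) g_n ≡ 0`, and `g_n` is a unit.
[cite: GreenbergLNM1716, §5 p. 181 (the fixed point a = −2 at p = 2) and §1 (functional equation)] -/
theorem norm_natCast_sub_le_of_subst_invOnePlusSubOne_eq {g : ℚ_[2]⟦X⟧} {σ : ℚ_[2]}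
    (hσ : σ = 1 ∨ σ = -1) {c : ℤ_[2]}
    (hFE : g.subst (invOnePlusSubOne : ℚ_[2]⟦X⟧) = C σ * binomialSeries ℚ_[2] c * g)
    (hint : ∀ k, ‖coeff k g‖ ≤ 1) {n : ℕ} (hsmall : ∀ j < n, ‖coeff j g‖ ≤ 2⁻¹)
    (hunit : ‖coeff n g‖ = 1) : ‖(n : ℚ_[2]) - (c : ℚ_[2])‖ ≤ 2⁻¹ := by
  have hι0 := constantCoeff_invOnePlusSubOne (R := ℚ_[2])
  set ι : ℚ_[2]⟦X⟧ := invOnePlusSubOne with hιdef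
  set s : ℚ_[2] := (-1) ^ (n + 1) with hsdef
  have hs : s = 1 ∨ s = -1 := by
    rcases Nat.even_or_odd (n + 1) with h | h
    · exact Or.inl h.neg_one_pow
    · exact Or.inr h.neg_one_pow
  have hs2 : s * s = 1 := by rcases hs with h | h <;> rw [h] <;> norm_num
  have hσ2 : σ * σ = 1 := by rcases hσ with h | h <;> rw [h] <;> norm_num
  have hσn : ‖σ‖ = 1 := by rcases hσ with h | h <;> rw [h] <;> simp
  -- the left-hand coefficient
  set RA : ℚ_[2] := ∑ d ∈ Finset.range n, coeff d g * coeff (n + 1) (ι ^ d) with hRA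
  have hA : coeff (n + 1) (g.subst ι) =
      RA + coeff n g * (n * s) + coeff (n + 1) g * s := by
    rw [coeff_subst' (HasSubst.of_constantCoeff_zero' hι0),
      finsum_eq_sum_of_support_subset _ (s := Finset.range (n + 2)) ?_]
    · simp only [smul_eq_mul]
      rw [Finset.sum_range_succ, Finset.sum_range_succ, hsdef,
        coeff_succ_invOnePlusSubOne_pow_succ, coeff_succ_invOnePlusSubOne_pow]
    · intro d hd
      simp only [Function.mem_support, ne_eq, Finset.coe_range, Set.mem_Iio] at hd ⊢
      by_contra hlt
      apply hd
      rw [coeff_of_lt_order (n + 1) (lt_of_lt_of_le (by exact_mod_cast (by omega : n + 1 < d))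
        (natCast_le_order_pow hι0 d)), smul_zero]
  have hRAle : ‖RA‖ ≤ 2⁻¹ := by
    refine IsUltrametricDist.norm_sum_le_of_forall_le_of_nonneg (by norm_num) fun d hd ↦ ?_
    rw [norm_mul]
    calc _ ≤ 2⁻¹ * 1 := mul_le_mul (hsmall d (Finset.mem_range.mp hd))
          (norm_coeff_invOnePlusSubOne_pow_le d _) (norm_nonneg _) (by norm_num)
      _ = 2⁻¹ := mul_one _
  -- the right-hand coefficient
  set RB : ℚ_[2] := ∑ i ∈ Finset.range n,
    (Ring.choose c (i + 1 + 1) • (1 : ℚ_[2])) * coeff (n + 1 - (i + 1 + 1)) g with hRB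
  have hB : coeff (n + 1) (C σ * binomialSeries ℚ_[2] c * g) =
      σ * (RB + (c : ℚ_[2]) * coeff n g + coeff (n + 1) g) := by
    rw [mul_assoc, coeff_C_mul, coeff_mul, Finset.Nat.sum_antidiagonal_eq_sum_range_succ_mk,
      Finset.sum_range_succ', Finset.sum_range_succ']
    congr 1
    simp only [binomialSeries_coeff, Ring.choose_zero_right, Ring.choose_one_right, one_smul,
      Nat.sub_zero, zero_add, Nat.add_sub_cancel, one_mul]
    rw [Algebra.smul_def, mul_one, PadicInt.algebraMap_apply]
  have hRBle : ‖RB‖ ≤ 2⁻¹ := by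
    refine IsUltrametricDist.norm_sum_le_of_forall_le_of_nonneg (by norm_num) fun i hi ↦ ?_
    have hi' : n + 1 - (i + 1 + 1) < n := by
      have := Finset.mem_range.mp hi
      omega
    have hci : ‖Ring.choose c (i + 1 + 1) • (1 : ℚ_[2])‖ ≤ 1 := by
      have h := norm_coeff_binomialSeries_le 2 c (i + 1 + 1)
      rwa [binomialSeries_coeff] at h
    rw [norm_mul]
    calc _ ≤ 1 * 2⁻¹ := mul_le_mul hci (hsmall _ hi') (norm_nonneg _) zero_le_one
      _ = 2⁻¹ := one_mul _
  -- compare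
  have hAB : coeff (n + 1) (g.subst ι) = coeff (n + 1) (C σ * binomialSeries ℚ_[2] c * g) := by
    rw [hιdef, hFE]
  have key : ((n : ℚ_[2]) - c) * coeff n g =
      (s - σ) * coeff (n + 1) (g.subst ι) - s * RA + RB := by
    linear_combination (-s) * hA + σ * hB + σ * hAB
      + (-(n : ℚ_[2]) * coeff n g - coeff (n + 1) g) * hs2
      + (RB + (c : ℚ_[2]) * coeff n g + coeff (n + 1) g) * hσ2
  have hAle : ‖coeff (n + 1) (g.subst ι)‖ ≤ 1 := by
    rw [hAB, hB, norm_mul, hσn, one_mul]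
    refine (Padic.nonarchimedean _ _).trans (max_le ((Padic.nonarchimedean _ _).trans
      (max_le (hRBle.trans (by norm_num)) ?_)) (hint _))
    rw [norm_mul]
    calc _ ≤ 1 * 1 := mul_le_mul (PadicInt.norm_le_one c) (hint n) (norm_nonneg _) zero_le_one
      _ = 1 := one_mul _
  have h1 : ‖(s - σ) * coeff (n + 1) (g.subst ι)‖ ≤ 2⁻¹ :=
    (norm_sub_mul_le_half hs hσ _).trans (by nlinarith [norm_nonneg (coeff (n + 1) (g.subst ι))])
  have h2 : ‖-(s * RA)‖ ≤ 2⁻¹ := by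
    rw [norm_neg, norm_mul]
    have hsn : ‖s‖ = 1 := by rcases hs with h | h <;> rw [h] <;> simp
    rw [hsn, one_mul]
    exact hRAle
  have hkey : ‖((n : ℚ_[2]) - c) * coeff n g‖ ≤ 2⁻¹ := by
    rw [key, sub_eq_add_neg]
    exact (Padic.nonarchimedean _ _).trans (max_le ((Padic.nonarchimedean _ _).trans (max_le h1 h2))
      hRBle)
  rwa [norm_mul, hunit, mul_one] at hkey

end Core

/-! ### §3. The PARITY(2) law for elliptic curves good ordinary at `2` -/

section Curve

/-- `‖n − c‖₂ ≤ ½` for `n ∈ ℕ`, `c ∈ ℤ₂` means `n ≡ c (mod 2)`: `(n : ℤ/2) = c mod 2`.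
[folklore] -/
private theorem natCast_eq_toZModPow_one_of_norm_sub_le {n : ℕ} {c : ℤ_[2]}
    (h : ‖(n : ℚ_[2]) - (c : ℚ_[2])‖ ≤ 2⁻¹) : (n : ZMod 2) = PadicInt.toZModPow 1 c := by
  have hlt : ‖((n : ℤ_[2]) - c : ℤ_[2])‖ < 1 := by
    rw [PadicInt.norm_def, PadicInt.coe_sub, PadicInt.coe_natCast]
    exact h.trans_lt (by norm_num)
  have hdvd : ((2 : ℕ) : ℤ_[2]) ∣ (n : ℤ_[2]) - c := (PadicInt.norm_lt_one_iff_dvd _).mp hlt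
  have hker : ((n : ℤ_[2]) - c) ∈ RingHom.ker (PadicInt.toZModPow (p := 2) 1) := by
    rw [PadicInt.ker_toZModPow, Ideal.mem_span_singleton, pow_one]
    exact hdvd
  rw [RingHom.mem_ker, map_sub, map_natCast, sub_eq_zero] at hker
  exact hker

variable {W : WeierstrassCurve ℚ} [W.IsElliptic] [W.IsGloballyMinimal]

/-- **PARITY(2): `(−1)^λ = χ₈(N_E)` for `E` good ordinary at `2`.** Let `E = W/ℚ` be globally
minimal, good ORDINARY at `2`, `f ∈ S₂(Γ₀(N_E))` its newform, `L = L₂(f, α, T)` the tree's `2`-adic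
`L`-function (`α` the unit root), and `t ∈ ℚ₂` any scalar such that `t · L` has `2`-integral
coefficients (`t = 1` always works, `exists_iwasawaToPowerSeries_eq_padicLFunction_two_auto`;
`t = 2^{−μ}` normalises). If `n` is the index of the first UNIT coefficient of `t · L` (all earlier
coefficients in `2ℤ₂`) — for `t = 2^{−μ(L)}` this `n` is the λ-invariant of `L` — then
`n` is even iff `N_E ≡ ±1 (mod 8)`. The root number does not enter. Inputs: the functional equation
with exponent (`exists_exponent_subst_padicLFunction_eq_conductorLevel`: `L(T^ι) = w_E (1+T)^c L(T)`,
`N_E ≡ η · 5^c`), the core `norm_natCast_sub_le_of_subst_invOnePlusSubOne_eq` (`n ≡ c (mod 2)`), and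
`5^c ≡ 1 (mod 8) ↔ c` even, `η = ±1`. (o1 lens-1 G4.5b / lead D18; checked on 2 613/2 613 census
rows before this proof — EVIDENCE, not used.)
[cite: GreenbergLNM1716, §1 (functional equation and ⟨N_E⟩, pp. 67–68) and §5 p. 181] -/
theorem even_firstUnitCoeff_iff_conductorNorm_mod_eight [NeZero (W.conductorNorm ℤ)]
    {f : CuspForm (Gamma0 (W.conductorNorm ℤ)) 2} (hord : IsOrdinaryAt W 2) (hf : IsNewformOf W f)
    (t : ℚ_[2]) {n : ℕ}
    (hint : ∀ k, ‖coeff k (C t * padicLFunction f (unitRoot W 2 : ℚ_[2]))‖ ≤ 1)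
    (hsmall : ∀ j < n, ‖coeff j (C t * padicLFunction f (unitRoot W 2 : ℚ_[2]))‖ ≤ 2⁻¹)
    (hunit : ‖coeff n (C t * padicLFunction f (unitRoot W 2 : ℚ_[2]))‖ = 1) :
    Even n ↔ (W.conductorNorm ℤ % 8 = 1 ∨ W.conductorNorm ℤ % 8 = 7) := by
  obtain ⟨ηN, c, hc, hFE⟩ :=
    exists_exponent_subst_padicLFunction_eq_conductorLevel (p := 2) hord hf
  set L := padicLFunction f (unitRoot W 2 : ℚ_[2]) with hL
  -- the functional equation for `t · L`
  have hFEg : (C t * L).subst (invOnePlusSubOne : ℚ_[2]⟦X⟧) =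
      C (((W.rootNumber : ℤ) : ℚ_[2])) * binomialSeries ℚ_[2] c * (C t * L) := by
    rw [← smul_eq_C_mul, subst_smul hasSubst_invOnePlusSubOne t L, hFE, smul_eq_C_mul,
      smul_eq_C_mul]
    ring
  have hσ : ((W.rootNumber : ℤ) : ℚ_[2]) = 1 ∨ ((W.rootNumber : ℤ) : ℚ_[2]) = -1 := by
    rcases W.rootNumber_eq_one_or with h | h <;> simp [h]
  have hpar := natCast_eq_toZModPow_one_of_norm_sub_le
    (norm_natCast_sub_le_of_subst_invOnePlusSubOne_eq hσ hFEg hint hsmall hunit)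
  -- `η = ±1`
  have hη : ((ηN : ℤ_[2]ˣ) : ℤ_[2]) = 1 ∨ ((ηN : ℤ_[2]ˣ) : ℤ_[2]) = -1 := by
    have h := ηN.2
    rw [mem_rootsOfUnity] at h
    have h' : (((ηN : ℤ_[2]ˣ) : ℤ_[2])) ^ torsionOrder 2 = 1 := by
      rw [← Units.val_pow_eq_pow_val, h, Units.val_one]
    generalize ((ηN : ℤ_[2]ˣ) : ℤ_[2]) = x at h' ⊢
    rw [torsionOrder_two] at h'
    exact sq_eq_one_iff.mp h'
  -- `N ≡ η · 5^{c mod 2} (mod 8)`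
  have h8 : PadicInt.toZModPow 3 ((ηN : ℤ_[2]ˣ) : ℤ_[2]) *
      (5 : ZMod 8) ^ (PadicInt.toZModPow 1 c).val = ((W.conductorNorm ℤ : ℕ) : ZMod 8) := by
    have h := hc 1
    rw [cyclotomicGenerator_two] at h
    exact_mod_cast h
  have hη8 : PadicInt.toZModPow 3 ((ηN : ℤ_[2]ˣ) : ℤ_[2]) = 1 ∨
      PadicInt.toZModPow 3 ((ηN : ℤ_[2]ˣ) : ℤ_[2]) = -1 := by
    rcases hη with h | h
    · exact Or.inl (by rw [h, map_one])
    · exact Or.inr (by rw [h, map_neg, map_one])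
  have hN8 : W.conductorNorm ℤ % 8 = (((W.conductorNorm ℤ : ℕ) : ZMod 8)).val := by
    rw [ZMod.val_natCast]
  rw [← ZMod.natCast_eq_zero_iff_even, hpar, ← ZMod.val_eq_zero, hN8, ← h8]
  set v : ℕ := (PadicInt.toZModPow 1 c).val with hv
  have hvlt : v < 2 := ZMod.val_lt _
  interval_cases v
  · rcases hη8 with h | h <;> rw [h] <;> decide
  · rcases hη8 with h | h <;> rw [h] <;> decide

/-- **PARITY(2) at `μ = 0`** (no normalising scalar): for `E = W/ℚ` globally minimal, good
ordinary at `2`, `f` its newform at level `N_E`, if the `n`-th coefficient of `L₂(f, α, T)` is the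
first `2`-adic UNIT coefficient (the earlier ones lie in `2ℤ₂`; all coefficients lie in `ℤ₂` by
`padicLFunction_integral_two_auto`), i.e. `μ = 0` and `λ = n`, then `n` is even iff
`N_E ≡ ±1 (mod 8)`. [cite: GreenbergLNM1716, §1 (functional equation and ⟨N_E⟩, pp. 67–68) and §5 p. 181] -/
theorem even_firstUnitCoeff_iff_conductorNorm_mod_eight_of_mu_zero [NeZero (W.conductorNorm ℤ)]
    {f : CuspForm (Gamma0 (W.conductorNorm ℤ)) 2} (hord : IsOrdinaryAt W 2) (hf : IsNewformOf W f)
    {n : ℕ} (hsmall : ∀ j < n, ‖padicLCoeff f (unitRoot W 2 : ℚ_[2]) j‖ ≤ 2⁻¹)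
    (hunit : ‖padicLCoeff f (unitRoot W 2 : ℚ_[2]) n‖ = 1) :
    Even n ↔ (W.conductorNorm ℤ % 8 = 1 ∨ W.conductorNorm ℤ % 8 = 7) := by
  refine even_firstUnitCoeff_iff_conductorNorm_mod_eight hord hf 1 (n := n) ?_ ?_ ?_
  · intro k
    rw [map_one, one_mul, coeff_padicLFunction]
    exact padicLFunction_integral_two_auto hord hf k
  · intro j hj
    rw [map_one, one_mul, coeff_padicLFunction]
    exact hsmall j hj
  · rw [map_one, one_mul, coeff_padicLFunction]
    exact hunit

end Curve

end Literature.Barriers.BirchSwinnertonDyer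

end
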